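import Summits.QuantumFields.YangMills.Theorems.F4SubCurvatureDoorFibreDichotomyShellLFAnalytic
import Mathlib
import HarnessLib

/-!
# LINE g21-B «fibre dichotomy» (⟨stmt-QuantumFields-23125⟩) — B5 helper: mass fibres of a cone-supported Laplace–Fourier measure
# (abstract disintegration package ⇒ a.e. fibre is a shell measure; the windowed Laplace–Fourier integrals disintegrate)

Helper toward the registered stub B5 `stub_fibreReduction` of `Cruxes/RationalToGeneral/Lines/fibre_dichotomy.lean` (:161–165, :176).  The
disintegration of a Laplace–Fourier measure `μ` on `ℝ × ℝ³` along the squared mass `massSq` is packaged ABSTRACTLY by a base measure `η` on `ℝ`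
and a kernel `ν : ℝ → Measure (ℝ × ℝ³)` with three properties (all discharged from Mathlib's `Measure.condKernel` in the assembly file):

* (dis)  `∫⁻_{massSq ∈ S} f dμ = ∫⁻_{s ∈ S} ∫⁻ f dν_s dη` for measurable `f ≥ 0` and measurable windows `S`;
* (fib)  `ν_s {massSq ≠ s} = 0` for `η`-a.e. `s`;
* (cone) `ν_s {E < ‖q⃗‖} = 0` for `η`-a.e. `s`.

From these and the Laplace integrability of `μ` (`∫ e^{−tE} dμ < ∞`, `t > 0`) we prove: `η`-a.e. fibre is a SHELL MEASURE of mass² `s`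
(`ae_isShellMeasure`, the hypothesis of B4), and the windowed Laplace–Fourier integrals disintegrate as Bochner integrals
(`setIntegral_lf_eq`, with the integrability of the fibre transforms `integrable_fibre_lf`).

Mathlib + tree only; no `sorry`; no new definitions.  HONEST LABEL: helper for a registered stub of an OPEN line; B5, S1, S2, ⟨23125⟩, ⟨23035⟩,
R2d and the Yang–Mills mass gap remain OPEN; no summit is proved by a line.
-/

noncomputable section

open MeasureTheory MeasureTheory.Measure Set Function Filter Topology ProbabilityTheory
open scoped BigOperators ENNReal

namespace Summit.QuantumFields.YangMills.Theorems.F4SubCurvatureDoorFibreReduction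

open Summit.QuantumFields.YangMills.Theorems.F4SubCurvatureDoorLaplaceFourierRegistered (E4 E3)
open Summit.QuantumFields.YangMills.Theorems.F4SubCurvatureDoorShellLFAnalytic (massSq IsShellMeasure)

variable {μ : Measure (ℝ × E3)} {η : Measure ℝ} {ν : Kernel ℝ (ℝ × E3)}

/-- `massSq` is measurable (it is continuous). -/
theorem measurable_massSq : Measurable (massSq : ℝ × E3 → ℝ) := by
  unfold massSq
  fun_prop

/-- The Laplace weight `e^{−tE}` is measurable on momentum space. -/
theorem measurable_expWeight (t : ℝ) : Measurable fun p : ℝ × E3 => ENNReal.ofReal (Real.exp (-(t * p.1))) :=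
  (Real.measurable_exp.comp ((measurable_const.mul measurable_fst).neg)).ennreal_ofReal

/-! ## The Laplace functional of the fibres -/

/-- **The Laplace transform disintegrates**: `∫⁻ e^{−tE} dμ = ∫ ∫⁻ e^{−tE} dν_s dη(s)`, and both are finite. -/
theorem lintegral_exp_fibre
    (hdis : ∀ S : Set ℝ, MeasurableSet S → ∀ f : ℝ × E3 → ℝ≥0∞, Measurable f →
      ∫⁻ p in massSq ⁻¹' S, f p ∂μ = ∫⁻ s in S, ∫⁻ p, f p ∂(ν s) ∂η)
    (hint : ∀ t : ℝ, 0 < t → Integrable (fun p : ℝ × E3 => Real.exp (-(t * p.1))) μ) {t : ℝ} (ht : 0 < t) :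
    ∫⁻ s, ∫⁻ p, ENNReal.ofReal (Real.exp (-(t * p.1))) ∂(ν s) ∂η = ∫⁻ p, ENNReal.ofReal (Real.exp (-(t * p.1))) ∂μ ∧
      ∫⁻ p, ENNReal.ofReal (Real.exp (-(t * p.1))) ∂μ < ∞ := by
  have h := hdis univ MeasurableSet.univ _ (measurable_expWeight t)
  rw [preimage_univ, Measure.restrict_univ, Measure.restrict_univ] at h
  exact ⟨h.symm, (hint t ht).lintegral_lt_top⟩

/-- For `η`-a.e. `s`, the fibre has finite Laplace transform at every `t = 1/(n+1)`. -/
theorem ae_lintegral_exp_lt_top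
    (hdis : ∀ S : Set ℝ, MeasurableSet S → ∀ f : ℝ × E3 → ℝ≥0∞, Measurable f →
      ∫⁻ p in massSq ⁻¹' S, f p ∂μ = ∫⁻ s in S, ∫⁻ p, f p ∂(ν s) ∂η)
    (hint : ∀ t : ℝ, 0 < t → Integrable (fun p : ℝ × E3 => Real.exp (-(t * p.1))) μ) :
    ∀ᵐ s ∂η, ∀ n : ℕ, ∫⁻ p, ENNReal.ofReal (Real.exp (-((1 / ((n : ℝ) + 1)) * p.1))) ∂(ν s) < ∞ := by
  rw [ae_all_iff]
  intro n
  have ht : (0 : ℝ) < 1 / ((n : ℝ) + 1) := by positivity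
  obtain ⟨heq, hfin⟩ := lintegral_exp_fibre hdis hint ht
  refine ae_lt_top (Measurable.lintegral_kernel (measurable_expWeight _)) ?_
  rw [heq]
  exact hfin.ne

/-- **`η`-a.e. fibre is a shell measure of squared mass `s`** (cone-carried, carried by `{massSq = s}`, Laplace-integrable for every `t > 0`). -/
theorem ae_isShellMeasure
    (hdis : ∀ S : Set ℝ, MeasurableSet S → ∀ f : ℝ × E3 → ℝ≥0∞, Measurable f →
      ∫⁻ p in massSq ⁻¹' S, f p ∂μ = ∫⁻ s in S, ∫⁻ p, f p ∂(ν s) ∂η)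
    (hfib : ∀ᵐ s ∂η, ν s {p | massSq p ≠ s} = 0) (hcone : ∀ᵐ s ∂η, ν s {p | p.1 < ‖p.2‖} = 0)
    (hint : ∀ t : ℝ, 0 < t → Integrable (fun p : ℝ × E3 => Real.exp (-(t * p.1))) μ) :
    ∀ᵐ s ∂η, IsShellMeasure (ν s) s := by
  filter_upwards [hfib, hcone, ae_lintegral_exp_lt_top hdis hint] with s hs1 hs2 hs3
  refine ⟨hs2, hs1, fun t ht => ?_⟩
  -- integrability of `e^{−tE}`: dominate by `e^{−E/(n+1)}` with `1/(n+1) < t` on the cone (`E ≥ 0` a.e.)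
  obtain ⟨n, hn⟩ := exists_nat_one_div_lt ht
  have hEpos : ∀ᵐ p ∂(ν s), 0 ≤ p.1 := by
    filter_upwards [measure_eq_zero_iff_ae_notMem.1 hs2] with p hp
    exact (norm_nonneg _).trans (not_lt.1 hp)
  refine ⟨(by fun_prop : Continuous fun p : ℝ × E3 => Real.exp (-(t * p.1))).aestronglyMeasurable, ?_⟩
  refine lt_of_le_of_lt (lintegral_mono_ae ?_) (hs3 n)
  filter_upwards [hEpos] with p hp
  rw [Real.enorm_eq_ofReal (Real.exp_pos _).le]
  exact ENNReal.ofReal_le_ofReal (Real.exp_le_exp.2 (by nlinarith))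

/-! ## Bochner form of the disintegration for the Laplace–Fourier integrand -/

/-- For a non-negative continuous integrand dominated by a multiple of `e^{−tE}`, the windowed `μ`-integral disintegrates as a Bochner integral,
and the fibre integrals are `η`-integrable. -/
theorem setIntegral_eq_of_nonneg
    (hdis : ∀ S : Set ℝ, MeasurableSet S → ∀ f : ℝ × E3 → ℝ≥0∞, Measurable f →
      ∫⁻ p in massSq ⁻¹' S, f p ∂μ = ∫⁻ s in S, ∫⁻ p, f p ∂(ν s) ∂η)
    (hint : ∀ t : ℝ, 0 < t → Integrable (fun p : ℝ × E3 => Real.exp (-(t * p.1))) μ)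
    {g : ℝ × E3 → ℝ} (hgc : Continuous g) (hg0 : ∀ p, 0 ≤ g p) {t C : ℝ} (ht : 0 < t) (hC : 0 ≤ C)
    (hgle : ∀ p, g p ≤ C * Real.exp (-(t * p.1))) {S : Set ℝ} (hS : MeasurableSet S) :
    ∫ p in massSq ⁻¹' S, g p ∂μ = ∫ s in S, (∫ p, g p ∂(ν s)) ∂η ∧
      Integrable (fun s => ∫ p, g p ∂(ν s)) η := by
  have hgm : Measurable g := hgc.measurable
  have hgm' : Measurable fun p => ENNReal.ofReal (g p) := hgm.ennreal_ofReal
  -- the fibre lintegrals `G s = ∫⁻ g dν_s` and their bound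
  set G : ℝ → ℝ≥0∞ := fun s => ∫⁻ p, ENNReal.ofReal (g p) ∂(ν s) with hG
  have hGm : Measurable G := Measurable.lintegral_kernel hgm'
  set W : ℝ → ℝ≥0∞ := fun s => ∫⁻ p, ENNReal.ofReal (Real.exp (-(t * p.1))) ∂(ν s) with hW
  have hWm : Measurable W := Measurable.lintegral_kernel (measurable_expWeight t)
  obtain ⟨hWeq, hWfin⟩ := lintegral_exp_fibre hdis hint ht
  have hGle : ∀ s, G s ≤ ENNReal.ofReal C * W s := fun s => by
    rw [hW, ← lintegral_const_mul _ (measurable_expWeight t)]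
    refine lintegral_mono fun p => ?_
    rw [← ENNReal.ofReal_mul hC]
    exact ENNReal.ofReal_le_ofReal (hgle p)
  have hGint : ∫⁻ s, G s ∂η < ∞ := by
    refine lt_of_le_of_lt (lintegral_mono hGle) ?_
    rw [lintegral_const_mul _ hWm, hWeq]
    exact ENNReal.mul_lt_top ENNReal.ofReal_lt_top hWfin
  have hGfin : ∀ᵐ s ∂η, G s < ∞ := ae_lt_top hGm hGint.ne
  -- the fibre Bochner integrals are `(G s).toReal`
  have hfib : ∀ s, ∫ p, g p ∂(ν s) = (G s).toReal := fun s =>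
    integral_eq_lintegral_of_nonneg_ae (Eventually.of_forall hg0) hgc.aestronglyMeasurable
  refine ⟨?_, ?_⟩
  · rw [integral_eq_lintegral_of_nonneg_ae (Eventually.of_forall hg0) hgc.aestronglyMeasurable,
      hdis S hS _ hgm']
    simp_rw [hfib]
    rw [integral_toReal hGm.aemeasurable (ae_restrict_of_ae hGfin)]
  · simp_rw [hfib]
    exact integrable_toReal_of_lintegral_ne_top hGm.aemeasurable hGint.ne

/-- **The windowed Laplace–Fourier integrals disintegrate** (Bochner form): for `t > 0`, `z⃗ ∈ ℝ³` and a measurable window `S`,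
`∫_{massSq ∈ S} e^{−tE} cos(q⃗·z⃗) dμ = ∫_{s ∈ S} (∫ e^{−tE} cos(q⃗·z⃗) dν_s) dη(s)`. -/
theorem setIntegral_lf_eq
    (hdis : ∀ S : Set ℝ, MeasurableSet S → ∀ f : ℝ × E3 → ℝ≥0∞, Measurable f →
      ∫⁻ p in massSq ⁻¹' S, f p ∂μ = ∫⁻ s in S, ∫⁻ p, f p ∂(ν s) ∂η)
    (hfib : ∀ᵐ s ∂η, ν s {p | massSq p ≠ s} = 0) (hcone : ∀ᵐ s ∂η, ν s {p | p.1 < ‖p.2‖} = 0)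
    (hint : ∀ t : ℝ, 0 < t → Integrable (fun p : ℝ × E3 => Real.exp (-(t * p.1))) μ)
    {t : ℝ} (ht : 0 < t) (z : E3) {S : Set ℝ} (hS : MeasurableSet S) :
    ∫ p in massSq ⁻¹' S, Real.exp (-(t * p.1)) * Real.cos (inner ℝ p.2 z) ∂μ =
      ∫ s in S, (∫ p, Real.exp (-(t * p.1)) * Real.cos (inner ℝ p.2 z) ∂(ν s)) ∂η := by
  -- `f = g₁ − g₂` with `g₁ = e^{−tE}(1 + cos)`, `g₂ = e^{−tE}`, both non-negative and dominated by `2 e^{−tE}`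
  have hc1 : Continuous fun p : ℝ × E3 => Real.exp (-(t * p.1)) * (1 + Real.cos (inner ℝ p.2 z)) := by fun_prop
  have hc2 : Continuous fun p : ℝ × E3 => Real.exp (-(t * p.1)) := by fun_prop
  have h01 : ∀ p : ℝ × E3, 0 ≤ Real.exp (-(t * p.1)) * (1 + Real.cos (inner ℝ p.2 z)) := fun p =>
    mul_nonneg (Real.exp_pos _).le (by linarith [Real.neg_one_le_cos (inner ℝ p.2 z)])
  have hle1 : ∀ p : ℝ × E3, Real.exp (-(t * p.1)) * (1 + Real.cos (inner ℝ p.2 z)) ≤ 2 * Real.exp (-(t * p.1)) := fun p => by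
    have := Real.cos_le_one (inner ℝ p.2 z)
    nlinarith [Real.exp_pos (-(t * p.1))]
  have hle2 : ∀ p : ℝ × E3, Real.exp (-(t * p.1)) ≤ 1 * Real.exp (-(t * p.1)) := fun p => by rw [one_mul]
  obtain ⟨e1, i1⟩ := setIntegral_eq_of_nonneg hdis hint hc1 h01 ht (by norm_num) hle1 hS
  obtain ⟨e2, i2⟩ := setIntegral_eq_of_nonneg hdis hint hc2 (fun p => (Real.exp_pos _).le) ht zero_le_one hle2 hS
  -- integrability on `μ|S` of the two pieces
  have hμ1 : Integrable (fun p : ℝ × E3 => Real.exp (-(t * p.1)) * (1 + Real.cos (inner ℝ p.2 z))) (μ.restrict (massSq ⁻¹' S)) :=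
    (((hint t ht).const_mul 2).mono' hc1.aestronglyMeasurable (Eventually.of_forall fun p => by
      rw [Real.norm_eq_abs, abs_of_nonneg (h01 p)]; exact hle1 p)).restrict
  have hμ2 : Integrable (fun p : ℝ × E3 => Real.exp (-(t * p.1))) (μ.restrict (massSq ⁻¹' S)) := (hint t ht).restrict
  have hsplitμ : ∫ p in massSq ⁻¹' S, Real.exp (-(t * p.1)) * Real.cos (inner ℝ p.2 z) ∂μ =
      (∫ p in massSq ⁻¹' S, Real.exp (-(t * p.1)) * (1 + Real.cos (inner ℝ p.2 z)) ∂μ) -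
        ∫ p in massSq ⁻¹' S, Real.exp (-(t * p.1)) ∂μ := by
    rw [← integral_sub hμ1 hμ2]
    exact integral_congr_ae (ae_of_all _ fun p => by ring)
  -- fibrewise splitting, valid for a.e. `s` (where the fibre is a shell measure)
  have hfibre : ∀ᵐ s ∂η, ∫ p, Real.exp (-(t * p.1)) * Real.cos (inner ℝ p.2 z) ∂(ν s) =
      (∫ p, Real.exp (-(t * p.1)) * (1 + Real.cos (inner ℝ p.2 z)) ∂(ν s)) - ∫ p, Real.exp (-(t * p.1)) ∂(ν s) := by
    filter_upwards [ae_isShellMeasure hdis hfib hcone hint] with s hs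
    have hν2 : Integrable (fun p : ℝ × E3 => Real.exp (-(t * p.1))) (ν s) := hs.2.2 t ht
    have hν1 : Integrable (fun p : ℝ × E3 => Real.exp (-(t * p.1)) * (1 + Real.cos (inner ℝ p.2 z))) (ν s) :=
      (hν2.const_mul 2).mono' hc1.aestronglyMeasurable (Eventually.of_forall fun p => by
        rw [Real.norm_eq_abs, abs_of_nonneg (h01 p)]; exact hle1 p)
    rw [← integral_sub hν1 hν2]
    exact integral_congr_ae (ae_of_all _ fun p => by ring)
  rw [hsplitμ, e1, e2, ← integral_sub i1.restrict i2.restrict]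
  exact (integral_congr_ae (ae_restrict_of_ae hfibre)).symm

/-- The fibre Laplace–Fourier transforms are `η`-integrable: `s ↦ ∫ e^{−tE} cos(q⃗·z⃗) dν_s ∈ L¹(η)` for `t > 0`. -/
theorem integrable_fibre_lf [IsSFiniteKernel ν]
    (hdis : ∀ S : Set ℝ, MeasurableSet S → ∀ f : ℝ × E3 → ℝ≥0∞, Measurable f →
      ∫⁻ p in massSq ⁻¹' S, f p ∂μ = ∫⁻ s in S, ∫⁻ p, f p ∂(ν s) ∂η)
    (hfib : ∀ᵐ s ∂η, ν s {p | massSq p ≠ s} = 0) (hcone : ∀ᵐ s ∂η, ν s {p | p.1 < ‖p.2‖} = 0)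
    (hint : ∀ t : ℝ, 0 < t → Integrable (fun p : ℝ × E3 => Real.exp (-(t * p.1))) μ)
    {t : ℝ} (ht : 0 < t) (z : E3) :
    Integrable (fun s => ∫ p, Real.exp (-(t * p.1)) * Real.cos (inner ℝ p.2 z) ∂(ν s)) η := by
  have hc2 : Continuous fun p : ℝ × E3 => Real.exp (-(t * p.1)) := by fun_prop
  have hle2 : ∀ p : ℝ × E3, Real.exp (-(t * p.1)) ≤ 1 * Real.exp (-(t * p.1)) := fun p => by rw [one_mul]
  obtain ⟨-, i2⟩ := setIntegral_eq_of_nonneg hdis hint hc2 (fun p => (Real.exp_pos _).le) ht zero_le_one hle2 MeasurableSet.univ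
  have hsm : StronglyMeasurable (uncurry fun (_ : ℝ) (p : ℝ × E3) => Real.exp (-(t * p.1)) * Real.cos (inner ℝ p.2 z)) :=
    (by fun_prop : Continuous (uncurry fun (_ : ℝ) (p : ℝ × E3) => Real.exp (-(t * p.1)) * Real.cos (inner ℝ p.2 z))).stronglyMeasurable
  refine i2.mono' (hsm.integral_kernel_prod_right (κ := ν)).aestronglyMeasurable ?_
  filter_upwards [ae_isShellMeasure hdis hfib hcone hint] with s hs
  rw [Real.norm_eq_abs, ← Real.norm_eq_abs]
  refine norm_integral_le_of_norm_le (hs.2.2 t ht) (ae_of_all _ fun p => ?_)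
  rw [norm_mul, Real.norm_eq_abs, Real.norm_eq_abs, abs_of_pos (Real.exp_pos _)]
  exact mul_le_of_le_one_right (Real.exp_pos _).le (Real.abs_cos_le_one _)

/-! ## Existence of the disintegration package (Mathlib's conditional kernel) -/

/-- **The disintegration package exists.**  For a Laplace-integrable (`∫ e^{−E} dμ < ∞`), cone-carried measure `μ` on momentum space, the
base measure `η = (massSq)_* (e^{−E}μ)` and the kernel `ν_s = e^{+E} · condKernel_s` (Mathlib `Measure.condKernel` of the push-forward of `e^{−E}μ`
along `p ↦ (massSq p, p)`, a finite measure on `ℝ × (ℝ × ℝ³)`, standard Borel fibre) satisfy (dis), (fib) and (cone). -/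
theorem disintegration_package (μ : Measure (ℝ × E3)) (hint : Integrable (fun p : ℝ × E3 => Real.exp (-(1 * p.1))) μ)
    (hcone : μ {p | p.1 < ‖p.2‖} = 0) :
    ∃ (η : Measure ℝ) (ν : Kernel ℝ (ℝ × E3)), IsFiniteMeasure η ∧ IsSFiniteKernel ν ∧
      (∀ S : Set ℝ, MeasurableSet S → ∀ f : ℝ × E3 → ℝ≥0∞, Measurable f →
        ∫⁻ p in massSq ⁻¹' S, f p ∂μ = ∫⁻ s in S, ∫⁻ p, f p ∂(ν s) ∂η) ∧
      (∀ᵐ s ∂η, ν s {p | massSq p ≠ s} = 0) ∧ (∀ᵐ s ∂η, ν s {p | p.1 < ‖p.2‖} = 0) := by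
  -- the finite measure `μ₁ = e^{-E} μ`, its push-forward `ρ` along `p ↦ (massSq p, p)` and the conditional kernel
  set w : ℝ × E3 → ℝ≥0∞ := fun p => ENNReal.ofReal (Real.exp (-(1 * p.1))) with hw
  have hwm : Measurable w := (Real.measurable_exp.comp ((measurable_const.mul measurable_fst).neg)).ennreal_ofReal
  set μ₁ : Measure (ℝ × E3) := μ.withDensity w with hμ₁
  haveI : IsFiniteMeasure μ₁ := by
    refine ⟨?_⟩
    rw [hμ₁, withDensity_apply _ MeasurableSet.univ, Measure.restrict_univ]
    exact hint.lintegral_lt_top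
  set Φ : ℝ × E3 → ℝ × (ℝ × E3) := fun p => (massSq p, p) with hΦ
  have hΦm : Measurable Φ := measurable_massSq.prodMk measurable_id
  set ρ : Measure (ℝ × (ℝ × E3)) := μ₁.map Φ with hρ
  haveI : IsFiniteMeasure ρ := Measure.isFiniteMeasure_map μ₁ Φ
  set κ : Kernel ℝ (ℝ × E3) := ρ.condKernel with hκ
  set d : ℝ → ℝ × E3 → ℝ≥0∞ := fun _ p => ENNReal.ofReal (Real.exp p.1) with hd
  have hdm : Measurable (uncurry d) := (Real.measurable_exp.comp (measurable_fst.comp measurable_snd)).ennreal_ofReal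
  set ν : Kernel ℝ (ℝ × E3) := Kernel.withDensity κ d with hν
  haveI hνs : IsSFiniteKernel ν := Kernel.IsSFiniteKernel.withDensity κ (fun _ _ => ENNReal.ofReal_ne_top)
  have hνapp : ∀ s, ν s = (κ s).withDensity (fun p => ENNReal.ofReal (Real.exp p.1)) := fun s => Kernel.withDensity_apply κ hdm s
  refine ⟨ρ.fst, ν, inferInstance, hνs, ?_, ?_, ?_⟩
  · -- (dis)
    intro S hS f hf
    have hem : Measurable fun p : ℝ × E3 => ENNReal.ofReal (Real.exp p.1) := (Real.measurable_exp.comp measurable_fst).ennreal_ofReal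
    have hG : Measurable fun p : ℝ × E3 => ENNReal.ofReal (Real.exp p.1) * f p := hem.mul hf
    have hF : Measurable fun x : ℝ × (ℝ × E3) => ENNReal.ofReal (Real.exp x.2.1) * f x.2 := hG.comp measurable_snd
    have hpre : Φ ⁻¹' (S ×ˢ (univ : Set (ℝ × E3))) = massSq ⁻¹' S := by
      ext p
      simp [hΦ]
    calc ∫⁻ p in massSq ⁻¹' S, f p ∂μ
        = ∫⁻ p in massSq ⁻¹' S, w p * (ENNReal.ofReal (Real.exp p.1) * f p) ∂μ := by
          refine setLIntegral_congr_fun (measurable_massSq hS) (fun p _ => ?_)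
          rw [hw, ← mul_assoc, ← ENNReal.ofReal_mul (Real.exp_pos _).le, ← Real.exp_add]
          simp
      _ = ∫⁻ p in massSq ⁻¹' S, ENNReal.ofReal (Real.exp p.1) * f p ∂μ₁ := by
          rw [hμ₁, restrict_withDensity (measurable_massSq hS), lintegral_withDensity_eq_lintegral_mul _ hwm hG]
          rfl
      _ = ∫⁻ x in S ×ˢ (univ : Set (ℝ × E3)), ENNReal.ofReal (Real.exp x.2.1) * f x.2 ∂ρ := by
          rw [hρ, setLIntegral_map (hS.prod MeasurableSet.univ) hF hΦm, hpre]
      _ = ∫⁻ s in S, ∫⁻ p, ENNReal.ofReal (Real.exp p.1) * f p ∂(κ s) ∂ρ.fst := by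
          rw [← Measure.setLIntegral_condKernel_univ_right hF hS]
      _ = ∫⁻ s in S, ∫⁻ p, f p ∂(ν s) ∂ρ.fst := by
          refine setLIntegral_congr_fun hS (fun s _ => ?_)
          rw [hνapp s, lintegral_withDensity_eq_lintegral_mul _ hem hf]
          rfl
  · -- (fib)
    have hs : MeasurableSet {x : ℝ × (ℝ × E3) | massSq x.2 ≠ x.1} :=
      (measurableSet_eq_fun (measurable_massSq.comp measurable_snd) measurable_fst).compl
    have h0 : ρ {x : ℝ × (ℝ × E3) | massSq x.2 ≠ x.1} = 0 := by
      rw [hρ, Measure.map_apply hΦm hs]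
      have : Φ ⁻¹' {x : ℝ × (ℝ × E3) | massSq x.2 ≠ x.1} = ∅ := by
        ext p; simp [hΦ]
      rw [this, measure_empty]
    have h1 := Measure.lintegral_condKernel_mem (ρ := ρ) hs
    rw [h0] at h1
    have h2 : ∀ᵐ s ∂ρ.fst, κ s {y : ℝ × E3 | (s, y) ∈ {x : ℝ × (ℝ × E3) | massSq x.2 ≠ x.1}} = 0 :=
      (lintegral_eq_zero_iff (Kernel.measurable_kernel_prodMk_left hs)).1 h1
    filter_upwards [h2] with s hs0
    rw [hνapp s]
    refine withDensity_absolutelyContinuous _ _ ?_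
    simpa using hs0
  · -- (cone)
    have hcm : MeasurableSet {p : ℝ × E3 | p.1 < ‖p.2‖} := measurableSet_lt measurable_fst measurable_snd.norm
    have hs : MeasurableSet {x : ℝ × (ℝ × E3) | x.2.1 < ‖x.2.2‖} :=
      measurableSet_lt (measurable_fst.comp measurable_snd) (measurable_snd.comp measurable_snd).norm
    have h0 : ρ {x : ℝ × (ℝ × E3) | x.2.1 < ‖x.2.2‖} = 0 := by
      rw [hρ, Measure.map_apply hΦm hs]
      have : Φ ⁻¹' {x : ℝ × (ℝ × E3) | x.2.1 < ‖x.2.2‖} = {p : ℝ × E3 | p.1 < ‖p.2‖} := by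
        ext p; simp [hΦ]
      rw [this, hμ₁]
      exact withDensity_absolutelyContinuous μ w hcone
    have h1 := Measure.lintegral_condKernel_mem (ρ := ρ) hs
    rw [h0] at h1
    have h2 : ∀ᵐ s ∂ρ.fst, κ s {y : ℝ × E3 | (s, y) ∈ {x : ℝ × (ℝ × E3) | x.2.1 < ‖x.2.2‖}} = 0 :=
      (lintegral_eq_zero_iff (Kernel.measurable_kernel_prodMk_left hs)).1 h1
    filter_upwards [h2] with s hs0
    rw [hνapp s]
    refine withDensity_absolutelyContinuous _ _ ?_
    simpa using hs0

end Summit.QuantumFields.YangMills.Theorems.F4SubCurvatureDoorFibreReduction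

end
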